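import Literature.MathematicalPhysics.QuantumManyBody.BoseGasPairCollisionCutoff
import Mathlib.Analysis.SpecialFunctions.SmoothTransition
import Mathlib.MeasureTheory.Measure.Lebesgue.EqHaar
import Mathlib.MeasureTheory.Constructions.Pi
import HarnessLib

/-!
# Crux `GroundStateRigidity` (stmt-AtomisticToContinuum-9072), line `Sketch`:
# the registered stub `stub_pairCutoff`

Supports (does not close) stmt-AtomisticToContinuum-9072; stub `stub_pairCutoff` of line Sketch
(lead c2). **A smooth symmetric cutoff of the `ε`-neighbourhood of the collision set** `{xᵢ = xⱼ}`
in `(ℝ³)^N` whose exceptional set and gradient energy inside the box `Λ_L^N` are `O(ε)`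
(codimension three). The cutoff is `χ(X) = θ(∑_{i ≠ j} f((xᵢ - xⱼ)/ε))` with the smooth step
`θ = 1 - smoothTransition` (`1` on `(-∞,0]`, `0` on `[1,∞)`) and a radial bump `f` on `ℝ³`
(`rIn = 1`, `rOut = 3/2`); its `C¹` regularity, symmetry, plateau properties and the uniform
gradient bound `‖Dχ‖ ≤ C(N)/ε`, with `Dχ = 0` off `U_{2ε} = {∃ i ≠ j, |xᵢ - xⱼ| < 2ε}`, come from
`Literature/…/BoseGasPairCollisionCutoff.lean` (namespace `BoseGas.PairCutoff`). Here the box is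
sliced at the particle `i` (Fubini, `piFinSuccAbove`, as in `CoulombBoxIntegrability.lean`) to get
`|U_r ∩ Λ^N| ≤ N² |B(0,r)| |Λ^{N-1}| = N² r³ |B(0,1)| |Λ^{N-1}|`, whence `|{χ ≠ 1} ∩ Λ^N| ≤ A ε` and
`∫_{Λ^N} |∇χ|² ≤ (3N C²/ε²) |U_{2ε} ∩ Λ^N| ≤ A ε` for `ε ≤ 1`.
-/

noncomputable section

open MeasureTheory Filter Set Metric
open scoped ENNReal NNReal Topology

namespace Summit.AtomisticToContinuum.BoseEinsteinCondensation.Theorems.GroundStateRigidity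

open Literature.MathematicalPhysics.QuantumManyBody.BoseGas
open Literature.MathematicalPhysics.QuantumManyBody.BoseGas.PairCutoff

namespace PairCutoffVolume

variable {N n : ℕ}

/-! ### The volume of the exceptional set in the box -/

/-- **Slicing bound**: `|Λ^{n+1} ∩ {|xᵢ - xⱼ| < r}| ≤ |B(0,r)| · |Λ^n|` for `i ≠ j` (slice at
the particle `i` as in `JelliumBoseGas.setLIntegral_boxN_inv_norm_sub_le`; integrate `xᵢ` over
the ball around `xⱼ` first). [folklore] -/
theorem volume_boxN_succ_inter_lt_le (i j : Fin (n + 1)) (hij : i ≠ j) (L r : ℝ) :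
    volume (boxN (n + 1) L ∩ {X : Config (n + 1) | dist (X i) (X j) < r}) ≤
      volume (ball (0 : Space) r) * volume (boxN n L) := by
  obtain ⟨k, hk⟩ := Fin.exists_succAbove_eq hij.symm
  set e := MeasurableEquiv.piFinSuccAbove (fun _ : Fin (n + 1) => Space) i with he
  have hmp : MeasurePreserving e volume (volume.prod volume) :=
    volume_preserving_piFinSuccAbove _ i
  -- adapted from `JelliumBoseGas.boxN_succ_eq_preimage`
  have hbox : boxN (n + 1) L = e ⁻¹' (box L ×ˢ boxN n L) := by
    ext X
    simp only [boxN, mem_setOf_eq, mem_preimage, he, MeasurableEquiv.piFinSuccAbove_apply,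
      Fin.insertNthEquiv_symm_apply, mem_prod, Fin.removeNth_apply]
    rw [Fin.forall_iff_succAbove i]
  have hS : MeasurableSet {X : Config (n + 1) | dist (X i) (X j) < r} :=
    (isOpen_lt (by fun_prop) continuous_const).measurableSet
  have hT : MeasurableSet {p : Space × Config n | dist p.1 (p.2 k) < r} :=
    (isOpen_lt (by fun_prop) continuous_const).measurableSet
  set G : Space × Config n → ℝ≥0∞ :=
    {p : Space × Config n | dist p.1 (p.2 k) < r}.indicator 1 with hG
  have hGm : Measurable G := measurable_one.indicator hT
  have hcomp : ∀ X : Config (n + 1),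
      {X : Config (n + 1) | dist (X i) (X j) < r}.indicator (1 : Config (n + 1) → ℝ≥0∞) X =
        G (e X) := by
    intro X
    simp only [hG, Set.indicator_apply, mem_setOf_eq, Pi.one_apply, he,
      MeasurableEquiv.piFinSuccAbove_apply, Fin.insertNthEquiv_symm_apply, Fin.removeNth_apply,
      hk]
  have hslice : ∀ R : Config n, ∫⁻ x, G (x, R) = volume (ball (0 : Space) r) := by
    intro R
    have h1 : (fun x => G (x, R)) = (ball (R k) r).indicator 1 := by
      funext x
      simp only [hG, Set.indicator, mem_setOf_eq, Pi.one_apply, Metric.mem_ball]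
    rw [h1, lintegral_indicator_one measurableSet_ball]
    exact Measure.addHaar_ball_center volume (R k) r
  rw [Set.inter_comm, ← Measure.restrict_apply hS, ← lintegral_indicator_one hS]
  simp_rw [hcomp]
  rw [hbox, hmp.setLIntegral_comp_preimage_emb e.measurableEmbedding,
    ← Measure.prod_restrict, lintegral_prod_symm _ hGm.aemeasurable]
  calc ∫⁻ R in boxN n L, ∫⁻ x in box L, G (x, R)
      ≤ ∫⁻ _R in boxN n L, volume (ball (0 : Space) r) :=
        lintegral_mono fun R => (setLIntegral_le_lintegral _ _).trans (hslice R).le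
    _ = volume (ball (0 : Space) r) * volume (boxN n L) := setLIntegral_const _ _

/-- Per ordered pair: `|Λ^N ∩ {i ≠ j, |xᵢ - xⱼ| < r}| ≤ |B(0,r)| · |Λ^{N-1}|`. [folklore] -/
theorem volume_boxN_inter_pair_le (i j : Fin N) (L r : ℝ) :
    volume (boxN N L ∩ {X : Config N | i ≠ j ∧ dist (X i) (X j) < r}) ≤
      volume (ball (0 : Space) r) * volume (boxN (N - 1) L) := by
  by_cases hij : i = j
  · simp [hij]
  cases N with
  | zero => exact i.elim0
  | succ n =>
    simp only [ne_eq, hij, not_false_eq_true, true_and]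
    exact volume_boxN_succ_inter_lt_le i j hij L r

/-- The exceptional set `U_r = {∃ i ≠ j, |xᵢ - xⱼ| < r}` as a finite union over ordered pairs.
[folklore] -/
theorem nearSet_eq_iUnion (N : ℕ) (r : ℝ) :
    {X : Config N | ∃ i j : Fin N, i ≠ j ∧ dist (X i) (X j) < r} =
      ⋃ i : Fin N, ⋃ j : Fin N, {X | i ≠ j ∧ dist (X i) (X j) < r} := by
  ext X
  simp

/-- The exceptional set `U_r` is open. [folklore] -/
theorem isOpen_nearSet (N : ℕ) (r : ℝ) :
    IsOpen {X : Config N | ∃ i j : Fin N, i ≠ j ∧ dist (X i) (X j) < r} := by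
  rw [nearSet_eq_iUnion]
  refine isOpen_iUnion fun i => isOpen_iUnion fun j => ?_
  by_cases h : i = j
  · simp [h]
  · simp only [ne_eq, h, not_false_eq_true, true_and]
    exact isOpen_lt (by fun_prop) continuous_const

/-- **`|Λ^N ∩ U_r| ≤ N² |B(0,r)| |Λ^{N-1}|`.** [folklore] -/
theorem volume_boxN_inter_nearSet_le (N : ℕ) (L r : ℝ) :
    volume (boxN N L ∩ {X : Config N | ∃ i j : Fin N, i ≠ j ∧ dist (X i) (X j) < r}) ≤
      (N : ℝ≥0∞) * N * (volume (ball (0 : Space) r) * volume (boxN (N - 1) L)) := by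
  rw [nearSet_eq_iUnion, Set.inter_iUnion]
  refine (measure_iUnion_fintype_le _ _).trans ?_
  calc ∑ i : Fin N, volume (boxN N L ∩ ⋃ j, {X : Config N | i ≠ j ∧ dist (X i) (X j) < r})
      ≤ ∑ i : Fin N, ∑ j : Fin N,
          volume (boxN N L ∩ {X : Config N | i ≠ j ∧ dist (X i) (X j) < r}) := by
        refine Finset.sum_le_sum fun i _ => ?_
        rw [Set.inter_iUnion]
        exact measure_iUnion_fintype_le _ _
    _ ≤ ∑ _i : Fin N, ∑ _j : Fin N, volume (ball (0 : Space) r) * volume (boxN (N - 1) L) :=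
        Finset.sum_le_sum fun i _ => Finset.sum_le_sum fun j _ => volume_boxN_inter_pair_le i j L r
    _ = (N : ℝ≥0∞) * N * (volume (ball (0 : Space) r) * volume (boxN (N - 1) L)) := by
        simp only [Finset.sum_const, Finset.card_univ, Fintype.card_fin, nsmul_eq_mul]
        ring

/-- `|B(0,r)| = r³ |B(0,1)|` in `ℝ³`. [folklore] -/
theorem volume_ball_space {r : ℝ} (hr : 0 ≤ r) :
    volume (ball (0 : Space) r) = ENNReal.ofReal (r ^ 3) * volume (ball (0 : Space) 1) := by
  rw [Measure.addHaar_ball volume (0 : Space) hr, finrank_euclideanSpace_fin]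

end PairCutoffVolume

open PairCutoffVolume in
/-- **Smooth symmetric pair cutoff** (stub `stub_pairCutoff` of line Sketch): for every `N`, `L > 0`
there is `A = A(N, L)` such that for every `ε ∈ (0, 1]` there is a `C¹` function
`χ : (ℝ³)^N → [0, 1]`, symmetric under permutations of the particles, `= 0` wherever some pair is
`ε`-close, `= 1` wherever all pairs are `2ε`-separated, with `|{χ ≠ 1} ∩ Λ^N| ≤ A ε` and
`∫_{Λ^N} |∇χ|² ≤ A ε` (the collision set has codimension three). [folklore] -/
theorem stub_pairCutoff :
    ∀ (N : ℕ) (L : ℝ), 0 < L → ∃ A : ℝ≥0, ∀ ε : ℝ, 0 < ε → ε ≤ 1 →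
      ∃ χ : Config N → ℝ, ContDiff ℝ 1 χ ∧ (∀ X, 0 ≤ χ X ∧ χ X ≤ 1) ∧
        (∀ (σ : Equiv.Perm (Fin N)) (X : Config N), χ (X ∘ σ) = χ X) ∧
        (∀ X : Config N, (∃ i j : Fin N, i ≠ j ∧ dist (X i) (X j) ≤ ε) → χ X = 0) ∧
        (∀ X : Config N, (∀ i j : Fin N, i ≠ j → 2 * ε ≤ dist (X i) (X j)) → χ X = 1) ∧
        volume {X : Config N | X ∈ boxN N L ∧ χ X ≠ 1} ≤ A * ENNReal.ofReal ε ∧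
        ∫⁻ X in boxN N L, realKinetic χ X ≤ A * ENNReal.ofReal ε := by
  intro N L _hL
  -- the profile `θ = 1 - smoothTransition`
  set θ : ℝ → ℝ := fun t => 1 - Real.smoothTransition t with hθ
  have hθC : ContDiff ℝ 1 θ := contDiff_const.sub Real.smoothTransition.contDiff
  have hθd : Differentiable ℝ θ := hθC.differentiable one_ne_zero
  have hθ0 : θ 0 = 1 := by simp [hθ, Real.smoothTransition.zero_of_nonpos le_rfl]
  have hθ1 : ∀ t, 1 ≤ t → θ t = 0 := fun t ht => by
    simp [hθ, Real.smoothTransition.one_of_one_le ht]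
  have hθm : ∀ t, 0 ≤ θ t ∧ θ t ≤ 1 := fun t =>
    ⟨sub_nonneg.2 (Real.smoothTransition.le_one t), sub_le_self _ (Real.smoothTransition.nonneg t)⟩
  obtain ⟨K, hK⟩ := (isCompact_Icc (a := (0 : ℝ)) (b := (N : ℝ) * N)).exists_bound_of_continuousOn
    (hθC.continuous_deriv le_rfl).continuousOn
  have hK0 : 0 ≤ K := (norm_nonneg _).trans (hK 0 ⟨le_rfl, by positivity⟩)
  -- the radial bump `f` (`= 1` on the unit ball, `= 0` off the ball of radius `3/2`)
  obtain ⟨f, hfIn, hfOut⟩ : ∃ f : ContDiffBump (0 : Space), f.rIn = 1 ∧ f.rOut = 3 / 2 :=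
    ⟨⟨1, 3 / 2, one_pos, by norm_num⟩, rfl, rfl⟩
  obtain ⟨M, hM0, hM⟩ := exists_bound_fderiv_bump f
  -- the volume constants
  obtain ⟨v₁, hv₁, hV₁⟩ : ∃ v : ℝ, 0 ≤ v ∧ volume (ball (0 : Space) 1) = ENNReal.ofReal v :=
    ⟨_, ENNReal.toReal_nonneg, (ENNReal.ofReal_toReal measure_ball_lt_top.ne).symm⟩
  obtain ⟨vB, hvB, hVB⟩ : ∃ v : ℝ, 0 ≤ v ∧ volume (boxN (N - 1) L) = ENNReal.ofReal v :=
    ⟨_, ENNReal.toReal_nonneg, (ENNReal.ofReal_toReal (volume_boxN_lt_top (N - 1) L).ne).symm⟩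
  set C : ℝ := K * ((N : ℝ) * N * (M * 2)) with hC
  set G : ℝ := (N : ℝ) * N * (8 * v₁ * vB) with hG
  have hG0 : 0 ≤ G := by positivity
  set Q : ℝ := 3 * N * C ^ 2 with hQ
  have hQ0 : 0 ≤ Q := by positivity
  have hGQ : 0 ≤ G * (1 + Q) := by positivity
  refine ⟨(G * (1 + Q)).toNNReal, fun ε hε hε1 => ?_⟩
  -- the exceptional set `U = U_{2ε}` and its volume `|U ∩ Λ^N| ≤ G ε³`
  set U : Set (Config N) := {X | ∃ i j : Fin N, i ≠ j ∧ dist (X i) (X j) < 2 * ε} with hU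
  have hUc : ∀ X, X ∉ U → ∀ i j : Fin N, i ≠ j → 2 * ε ≤ dist (X i) (X j) :=
    fun X hX i j hij => not_lt.1 fun hlt => hX ⟨i, j, hij, hlt⟩
  have hUm : MeasurableSet U := (isOpen_nearSet N (2 * ε)).measurableSet
  have hgeo : volume (boxN N L ∩ U) ≤ ENNReal.ofReal (G * ε ^ 3) := by
    refine (volume_boxN_inter_nearSet_le N L (2 * ε)).trans (le_of_eq ?_)
    rw [volume_ball_space (by positivity : (0 : ℝ) ≤ 2 * ε), hV₁, hVB, ← ENNReal.ofReal_natCast]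
    simp (disch := positivity) only [← ENNReal.ofReal_mul]
    rw [hG]
    congr 1
    ring
  -- the cutoff `χ = θ ∘ s`
  set χ : Config N → ℝ :=
    fun X => θ (∑ i, ∑ j, if i = j then (0 : ℝ) else f (ε⁻¹ • (X i - X j))) with hχ
  have h1 : ∀ X : Config N, (∀ i j : Fin N, i ≠ j → 2 * ε ≤ dist (X i) (X j)) → χ X = 1 := by
    intro X hX
    simp only [hχ]
    rw [pairSum_eq_zero f hε fun i j hij => ?_, hθ0]
    rw [hfOut]
    linarith [hX i j hij]
  have hDle : ∀ X, ‖fderiv ℝ χ X‖ ≤ C / ε := fun X => by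
    refine (norm_fderiv_cutoff_le hθd hK0 hK f hM0 hM hε X).trans (le_of_eq ?_)
    rw [hC]
    ring
  have hD0 : ∀ X, X ∉ U → fderiv ℝ χ X = 0 := fun X hX =>
    fderiv_cutoff_eq_zero hθd f hε fun i j hij => by
      rw [hfOut]
      linarith [hUc X hX i j hij]
  refine ⟨χ, cutoff_contDiff hθC f ε, fun X => hθm _, fun σ X => ?_, fun X hX => ?_, h1, ?_, ?_⟩
  · -- symmetry
    simp only [hχ, Function.comp_apply]
    rw [pairSum_comp_perm f ε σ X]
  · -- vanishing near the collision set
    refine hθ1 _ (one_le_pairSum f hε ?_)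
    simpa [hfIn] using hX
  · -- the exceptional set `{χ ≠ 1} ∩ Λ^N ⊆ U ∩ Λ^N`
    calc volume {X : Config N | X ∈ boxN N L ∧ χ X ≠ 1}
        ≤ volume (boxN N L ∩ U) := by
          refine measure_mono fun X hX => ⟨hX.1, ?_⟩
          by_contra hn
          exact hX.2 (h1 X (hUc X hn))
      _ ≤ ENNReal.ofReal (G * ε ^ 3) := hgeo
      _ ≤ ENNReal.ofReal (G * (1 + Q) * ε) := by
          refine ENNReal.ofReal_le_ofReal ?_
          have h3 : ε ^ 3 ≤ ε := pow_le_of_le_one hε.le hε1 three_ne_zero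
          have h4 : 0 ≤ G * ε * Q := by positivity
          calc G * ε ^ 3 ≤ G * ε := mul_le_mul_of_nonneg_left h3 hG0
            _ ≤ G * ε + G * ε * Q := le_add_of_nonneg_right h4
            _ = G * (1 + Q) * ε := by ring
      _ = ((G * (1 + Q)).toNNReal : ℝ≥0∞) * ENNReal.ofReal ε := by
          rw [ENNReal.ofReal_mul hGQ]
          rfl
  · -- the gradient energy `∫_{Λ^N} |∇χ|² ≤ (Q/ε²) |U ∩ Λ^N|`
    have hQε : ∀ X, realKinetic χ X ≤ U.indicator (fun _ => ENNReal.ofReal (Q / ε ^ 2)) X := by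
      intro X
      by_cases hX : X ∈ U
      · rw [Set.indicator_of_mem hX]
        refine (realKinetic_le_of_norm_fderiv_le (hDle X)).trans (le_of_eq ?_)
        rw [hQ, div_pow]
        congr 1
        ring
      · rw [Set.indicator_of_notMem hX, realKinetic_eq_zero_of_fderiv (hD0 X hX)]
    calc ∫⁻ X in boxN N L, realKinetic χ X
        ≤ ∫⁻ X in boxN N L, U.indicator (fun _ => ENNReal.ofReal (Q / ε ^ 2)) X :=
          lintegral_mono hQε
      _ = ENNReal.ofReal (Q / ε ^ 2) * volume (boxN N L ∩ U) := by
          rw [lintegral_indicator_const hUm, Measure.restrict_apply hUm, Set.inter_comm]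
      _ ≤ ENNReal.ofReal (Q / ε ^ 2) * ENNReal.ofReal (G * ε ^ 3) := by gcongr
      _ = ENNReal.ofReal (Q * G * ε) := by
          rw [← ENNReal.ofReal_mul (p := Q / ε ^ 2) (by positivity)]
          congr 1
          rw [div_mul_eq_mul_div, div_eq_iff (by positivity)]
          ring
      _ ≤ ENNReal.ofReal (G * (1 + Q) * ε) := by
          refine ENNReal.ofReal_le_ofReal ?_
          have h5 : 0 ≤ G * ε := by positivity
          calc Q * G * ε ≤ Q * G * ε + G * ε := le_add_of_nonneg_right h5
            _ = G * (1 + Q) * ε := by ring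
      _ = ((G * (1 + Q)).toNNReal : ℝ≥0∞) * ENNReal.ofReal ε := by
          rw [ENNReal.ofReal_mul hGQ]
          rfl

end Summit.AtomisticToContinuum.BoseEinsteinCondensation.Theorems.GroundStateRigidity
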